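/-
Copyright (c) 2026. All rights reserved.
Released under Apache 2.0 license as described in the file LICENSE.
Authors: abc-iut cell, prover seat abc-iut-w5-d017 (wave 5, gen 5).
-/
import Summits.ABC.IUTFork.Cor312Ind3IteratesVacuityRamificationCriterion
import Literature.IUT.LogVolume.UnitLogWildDyadicInhabited
import HarnessLib

/-!
# (Ind3) honest iterates at DYADIC places with `2 ∣ e(v|2)`, `f(v|2) ≥ 2`: depth `2` is inhabited

Proof-only sequel (theorems, no definitions) of `Cor312Ind3IteratesVacuityRamificationCriterion.lean`
(abc-iut-w5-d017: at odd `p_v` the honest depth-`2` (Ind3) image at `v` is inhabited iff `p_v ∣ e(v|p_v)`;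
at any `p_v`, `p_v ∤ e ⇒` empty) and of abc-iut-w5-d172's `Cor312Ind3IteratesVacuityWildDyadic.lean`
(`(p, e, f) = (2, 2, 1)`: empty).  It transports abc-iut-w5-d017's local dyadic theorem
`Literature.IUT.LogVolume.RamificationCriterion.exists_norm_unitLog_eq_one_of_two_dvd`
(`2 ∣ e(K/ℚ₂)`, `f(K/ℚ₂) ≥ 2` ⇒ some unit has a unit `2`-adic logarithm) to the completions:

* `Real.nonarchIterImage_analyticLogv_two_nonempty_of_two_dvd` — **at a place `v ∣ 2` with `2 ∣ e(v|2)` and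
  `f(v|2) ≥ 2`, the honest depth-`2` image is INHABITED**.

Relevance: in [IUTchI] Def. 3.1 the field `F` contains `√−1`, so every `v ∣ 2` of such an `F` has even
`e(v|2)`; by this file the dyadic depth-`2` clauses are then non-vacuous at every `v ∣ 2` with `f(v|2) ≥ 2`
(the case `f(v|2) = 1`, `4 ∣ e(v|2)` stays undecided here).  Honest framing: statements ABOUT THE MODEL;
nothing here asserts or denies [IUTchIII] Cor. 3.12 or takes a side; census ≠ verdict; typed ≠ proved.
No definitions, no Prop-valued fact (D-0067 (1)).
-/

noncomputable section

open Set

namespace Summit.ABC.IUTFork.Thm311.Real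

open NumberField IsDedekindDomain Literature.IUT.LogVolume Literature.IUT.LogThetaLattice
  Literature.NumberTheory.NumberFields

variable {F : Type} [Field F] [NumberField F]

/-- In the rescaled completion at a place over `2` with `2 ∣ e(v|2)` and `f(v|2) ≥ 2` there is an element
of norm `1` whose `2`-adic logarithm has norm `1` (`e(F_v) = e(v|2)`, `f(F_v) = f(v|2)` by abc-iut-S7's
`absRamificationIdx_rescaledCompletion` / `residueDegree_rescaledCompletion`).
[cite: NeukirchANT1999, Ch. II (5.5)] -/
theorem exists_norm_rescaled_and_unitLog_eq_one_of_two_dvd (v : HeightOneSpectrum (𝓞 F)) (p : ℕ)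
    [Fact p.Prime] (hv : ((p : ℕ) : 𝓞 F) ∈ v.asIdeal) (hp2 : p = 2) (he : 2 ∣ v.asIdeal.ramificationIdx ℤ)
    (hf : 2 ≤ v.asIdeal.inertiaDeg ℤ) :
    ∃ y : v.adicCompletion F, ‖RescaledCompletion.of F p v hv y‖ = 1 ∧
      ‖unitLog (RescaledCompletion.of F p v hv y)‖ = 1 := by
  subst hp2
  have he' : 2 ∣ absRamificationIdx 2 (RescaledCompletion F 2 v hv) := by
    rwa [absRamificationIdx_rescaledCompletion]
  have hf' : 2 ≤ residueDegree 2 (RescaledCompletion F 2 v hv) := by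
    rwa [residueDegree_rescaledCompletion]
  obtain ⟨u, hu, hlog⟩ := RamificationCriterion.exists_norm_unitLog_eq_one_of_two_dvd he' hf'
  exact ⟨(RescaledCompletion.of F 2 v hv).symm u, by rwa [RingEquiv.apply_symm_apply],
    by rwa [RingEquiv.apply_symm_apply]⟩

/-- **At a finite place `v ∣ 2` with `2 ∣ e(v|2)` and `f(v|2) ≥ 2`, the honest depth-`2` nonarchimedean
(Ind3) iterate image for the analytic logarithms is NONEMPTY.** [claim: Mochizuki2012, status: disputed] -/
theorem nonarchIterImage_analyticLogv_two_nonempty_of_two_dvd (v : HeightOneSpectrum (𝓞 F))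
    (h2 : residueChar F v = 2) (he : 2 ∣ v.asIdeal.ramificationIdx ℤ) (hf : 2 ≤ v.asIdeal.inertiaDeg ℤ) :
    (nonarchIterImage (analyticLogv F) v 2).Nonempty := by
  haveI : Fact (residueChar F v).Prime := ⟨residueChar_prime F v⟩
  obtain ⟨y, hy1, hylog⟩ := exists_norm_rescaled_and_unitLog_eq_one_of_two_dvd v (residueChar F v)
    (natCast_residueChar_mem F v) h2 he hf
  obtain ⟨w, hw⟩ := exists_unit_coe_eq_of_norm_rescaled_eq_one v (residueChar F v)
    (natCast_residueChar_mem F v) y hy1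
  have hlog : ‖RescaledCompletion.of F (residueChar F v) v (natCast_residueChar_mem F v)
      (analyticLogv F v (Additive.ofMul w))‖ = 1 := by
    rw [analyticLogv_apply, RingEquiv.apply_symm_apply, hw]
    exact hylog
  obtain ⟨u, hu⟩ := exists_unit_coe_eq_of_norm_rescaled_eq_one v (residueChar F v)
    (natCast_residueChar_mem F v) (analyticLogv F v (Additive.ofMul w)) hlog
  exact nonarchIterImage_two_nonempty_of_exists_eq_coe_unit (analyticLogv F) v ⟨w, u, hu.symm⟩

/-- … so the per-place honest family `Real.iterImage (analyticLogv F) 2` is nonempty at such a dyadic `v`.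
[claim: Mochizuki2012, status: disputed] -/
theorem iterImage_analyticLogv_two_inr_nonempty_of_two_dvd (v : HeightOneSpectrum (𝓞 F))
    (h2 : residueChar F v = 2) (he : 2 ∣ v.asIdeal.ramificationIdx ℤ) (hf : 2 ≤ v.asIdeal.inertiaDeg ℤ) :
    (iterImage (analyticLogv F) 2 (.inr v : Place F)).Nonempty :=
  nonarchIterImage_analyticLogv_two_nonempty_of_two_dvd v h2 he hf

/-- **Dyadic places, packet level**: at `v_ℚ = 2` under a place `w` with `2 ∣ e(w|2)`, `f(w|2) ≥ 2`, the
honest depth-`2` component at `w` is INHABITED. [claim: Mochizuki2012, status: disputed] -/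
theorem honestU_inr_two_nonempty_of_two_dvd (X : PilotData F) (m : ℤ) {vQ : (thetaIndex X).VQ}
    (w : HeightOneSpectrum (𝓞 F)) (hw : (thetaIndex X).over (.inr w) = vQ)
    (h2 : residueChar F w = 2) (he : 2 ∣ w.asIdeal.ramificationIdx ℤ) (hf : 2 ≤ w.asIdeal.inertiaDeg ℤ) :
    (honestU X (analyticLogv F) m 2 vQ ⟨.inr w, hw⟩).Nonempty :=
  nonarchIterImage_analyticLogv_two_nonempty_of_two_dvd w h2 he hf

/-- **The dyadic dichotomy in `e` when `f(v|2) ≥ 2`**: the honest depth-`2` image at `v ∣ 2` is inhabited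
iff `2 ∣ e(v|2)` (the "only if" half is `Real.nonarchIterImage_add_two_eq_empty_of_not_dvd`, valid for
every `f`). [claim: Mochizuki2012, status: disputed] -/
theorem nonarchIterImage_analyticLogv_two_nonempty_iff_two_dvd (v : HeightOneSpectrum (𝓞 F))
    (h2 : residueChar F v = 2) (hf : 2 ≤ v.asIdeal.inertiaDeg ℤ) :
    (nonarchIterImage (analyticLogv F) v 2).Nonempty ↔ 2 ∣ v.asIdeal.ramificationIdx ℤ := by
  refine ⟨fun h ↦ ?_, fun he ↦ nonarchIterImage_analyticLogv_two_nonempty_of_two_dvd v h2 he hf⟩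
  by_contra he
  rw [nonarchIterImage_add_two_eq_empty_of_not_dvd v (h2 ▸ he) 0] at h
  exact Set.not_nonempty_empty h

end Summit.ABC.IUTFork.Thm311.Real

end
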